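import Summits.HodgeConjecture.HodgeConjecture.Theorems.H413OmegaAtLineGramCoinv
import Summits.HodgeConjecture.HodgeConjecture.Theorems.H413OmegaAtLineToReference
import HarnessLib

/-!
# FLOOR-0 P4, seat S4′(i) ∕ S4b, step (1c) — the pin-spelled `ω` at the admissible line IS a twist of the model's coinvariants at `splittingOf h`
# (composition of ★ p795555 `exists_coinv_equiv_TW_lineVec` and ★ p796264 `exists_coinv_equiv_chiSplitting_splittingOf`)

Cell hodgecm-mathlib (D-0151), FLOOR 0, crux item H413 = stmt-HodgeConjecture-24833; P4 line (ed. 2), stub S4b.  Author F0P4-p01 (g0) (seat (i)); SEAT-i MEMO v3.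
`--supports stmt-HodgeConjecture-24833 --as helper`.  DEF-FREE.

**`exists_coinv_equiv_TW_splittingOf`**: for the pin data `(T_W a, J_W a, chiSplittingLine θ …)` at a line `a ∈ (L⁺)ˣ` (ANY proof args; at the pin's `isSymm_TW`∕
`isUnit_det_TW`∕`JW_eq` the source IS `omegaAtLine[sChiD θ] a χ` with `χW := lineChar a χ`), ANY character `χW`, and ANY compatible splitting `h` of the
model-spelled line datum `(diagonal dV, diagonal (lineVec ↑a))` (e.g. ★ `ThetaDistAtLine.compat_line₀`): there are a continuous character `χtw` of the finite-adelic
pair and `Ψ : Coinv (finPairRepW[J_W a, chiSplittingLine]) χW ≃ₗ[ℂ] Coinv ((finPairRep[splittingOf h]) ∘ inr) χ₁`, `χ₁ := (χtw ∘ inr)⁻¹ · (χW ∘ subgroupCongr⁻¹)`, with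
`Ψ (mk f) = mk f` and `Ψ (weilCoinv k x) = χtw (k,1) • rep k (Ψ x)` — EXACTLY the `(Ψ, λ)` of ★ `exists_holReal_of_transport` for S4b (`λ g := χtw (ιVE V g, 1)`).
HC_CM is proved only modulo the printed citations until rung 0 closes.

## References
* [GelbartRogawski1991] S. Gelbart, J. Rogawski, Invent. Math. 105 (1991), §3.1 Prop. 3.1.1 p. 455, Remark p. 457 L4–13.
* [Liu2021] Y. Liu, Camb. J. Math. 9 (2021), Def. 4.11, App. D §D.1 Steps 1–3.
* Tree: ★ `Theorems/H413OmegaAtLineGramCoinv`, ★ `Theorems/H413OmegaAtLineToReference`.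
-/

set_option autoImplicit false
set_option linter.dupNamespace false

noncomputable section

open scoped Matrix Kronecker
open NumberField IsDedekindDomain
open Literature.NumberTheory.Automorphic Literature.NumberTheory.Automorphic.UnitaryGroup
open Literature.NumberTheory.Weil1964
open Literature.NumberTheory.GelbartRogawski1991 Literature.NumberTheory.GelbartRogawski1991.UnitaryDualPair
open Literature.NumberTheory.GelbartRogawski1991.UnitaryDualPair.WeilCoinv
open Literature.NumberTheory.Automorphic.Liu2021.Def411WeilCarriersDoubling
open Literature.NumberTheory.Automorphic.Liu2021.Def411WeilCarriers (TW JW JW_eq isSymm_TW isUnit_det_TW)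
open Literature.NumberTheory.GelbartRogawski1991.GRConstruction (Fp)
open Literature.NumberTheory.GaloisRepresentations (HeckeCharacter)
open Literature.RepresentationTheory.HarrisKudlaSweet1996 (IsSplittingChar)

namespace Summit.HodgeConjecture.HodgeConjecture.Cruxes.H413.ThetaJunction

variable (L : Type) [Field L] [NumberField L] [IsCMField L] {N' n' : ℕ} (e₁ : Fin N' × Fin 1 ≃ Fin n')
  (dV₁ : Fin N' → L) (hdV₁ : ∀ i, IsCMField.complexConj L (dV₁ i) = dV₁ i) (hdV₁0 : ∀ i, dV₁ i ≠ 0)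
  (θ : HeckeCharacter L) (hθu : θ.IsUnitary) (hθs : IsSplittingChar L 1 θ)
  (a : (↥(maximalRealSubfield L))ˣ)
  (hW : (TW (↥(maximalRealSubfield L)) a).IsSymm) (hWd : IsUnit (TW (↥(maximalRealSubfield L)) a).det)
  (hJW : JW (↥(maximalRealSubfield L)) L a = (TW (↥(maximalRealSubfield L)) a).map (algebraMap (↥(maximalRealSubfield L)) L))
  (χW : UnitaryGroup.finAdelic (↥(maximalRealSubfield L)) L (IsCMField.complexConj L) 1 (JW (↥(maximalRealSubfield L)) L a) →* ℂˣ)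
  (h : (splittingDatum (Fp L) L (IsCMField.complexConj L) N' 1 e₁ (Matrix.diagonal dV₁)
      (Matrix.diagonal (lineVec L ((a : ↥(maximalRealSubfield L)) : L))) (complexConj_imagUnit L)
      (imagUnit_ne_zero L) (imagUnit_mul_self L) (realDiagonal_isSymm L dV₁ hdV₁) (realDiagonal_isSymm L _ (complexConj_lineVec_coe L a))
      (isUnit_det_realDiagonal L dV₁ hdV₁ hdV₁0) (isUnit_det_realDiagonal L _ (complexConj_lineVec_coe L a) (lineVec_coe_ne_zero L a))
      (realDiagonal_map L dV₁ hdV₁).symm (realDiagonal_map L _ (complexConj_lineVec_coe L a)).symm).CompatibleSplitting)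

set_option maxHeartbeats 4000000 in
/-- **step (1c)**: see the module docstring. [cite: GelbartRogawski1991, §3.1 Prop. 3.1.1 p. 455; Remark p. 457 L4–13] [cite: Liu2021, App. D §D.1 Steps 1–3] -/
theorem exists_coinv_equiv_TW_splittingOf :
    ∃ (χtw : UnitaryGroup.finAdelic (Fp L) L (IsCMField.complexConj L) N' (Matrix.diagonal dV₁) ×
          UnitaryGroup.finAdelic (Fp L) L (IsCMField.complexConj L) 1 (Matrix.diagonal (lineVec L ((a : ↥(maximalRealSubfield L)) : L))) →* ℂˣ),
      Continuous χtw ∧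
      ∃ Ψ : Literature.RepresentationTheory.TwistedCoinv.Coinv
            (finPairRepW (↥(maximalRealSubfield L)) L (IsCMField.complexConj L) N' 1 e₁ (Matrix.diagonal dV₁) (JW (↥(maximalRealSubfield L)) L a)
              (complexConj_imagUnit L) (imagUnit_ne_zero L) (imagUnit_mul_self L) (realDiagonal_isSymm L dV₁ hdV₁) hW
              (isUnit_det_realDiagonal L dV₁ hdV₁ hdV₁0) hWd (realDiagonal_map L dV₁ hdV₁).symm hJW
              (isCompatible_chiSplittingLine L e₁ dV₁ hdV₁ hdV₁0 θ hθu hθs (TW (↥(maximalRealSubfield L)) a) hW hWd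
                (JW (↥(maximalRealSubfield L)) L a) hJW))
            χW ≃ₗ[ℂ]
          Literature.RepresentationTheory.TwistedCoinv.Coinv
            ((finPairRep (Fp L) L (IsCMField.complexConj L) N' 1 e₁ (Matrix.diagonal dV₁) (Matrix.diagonal (lineVec L ((a : ↥(maximalRealSubfield L)) : L))) (complexConj_imagUnit L)
              (imagUnit_ne_zero L) (imagUnit_mul_self L) (realDiagonal_isSymm L dV₁ hdV₁) (realDiagonal_isSymm L _ (complexConj_lineVec_coe L a))
              (isUnit_det_realDiagonal L dV₁ hdV₁ hdV₁0) (isUnit_det_realDiagonal L _ (complexConj_lineVec_coe L a) (lineVec_coe_ne_zero L a)) (realDiagonal_map L dV₁ hdV₁).symm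
              (realDiagonal_map L _ (complexConj_lineVec_coe L a)).symm
              (splittingOf_isCompatible _ _ _ _ _ _ _ _ _ _ _ _ _ _ _ _ _ h)).comp (MonoidHom.inr _ _))
            ((χtw.comp (MonoidHom.inr _ _))⁻¹ * (χW.comp (MulEquiv.subgroupCongr (finAdelic_JW_eq L a)).symm.toMonoidHom)),
        (∀ f, Ψ (Literature.RepresentationTheory.TwistedCoinv.mk _ χW f) = Literature.RepresentationTheory.TwistedCoinv.mk _ _ f) ∧
        ∀ (k : UnitaryGroup.finAdelic (Fp L) L (IsCMField.complexConj L) N' (Matrix.diagonal dV₁)) (x : Literature.RepresentationTheory.TwistedCoinv.Coinv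
            (finPairRepW (↥(maximalRealSubfield L)) L (IsCMField.complexConj L) N' 1 e₁ (Matrix.diagonal dV₁) (JW (↥(maximalRealSubfield L)) L a)
              (complexConj_imagUnit L) (imagUnit_ne_zero L) (imagUnit_mul_self L) (realDiagonal_isSymm L dV₁ hdV₁) hW
              (isUnit_det_realDiagonal L dV₁ hdV₁ hdV₁0) hWd (realDiagonal_map L dV₁ hdV₁).symm hJW
              (isCompatible_chiSplittingLine L e₁ dV₁ hdV₁ hdV₁0 θ hθu hθs (TW (↥(maximalRealSubfield L)) a) hW hWd
                (JW (↥(maximalRealSubfield L)) L a) hJW))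
            χW),
          Ψ (weilCoinv (↥(maximalRealSubfield L)) L (IsCMField.complexConj L) N' 1 e₁ (Matrix.diagonal dV₁) (JW (↥(maximalRealSubfield L)) L a)
                (complexConj_imagUnit L) (imagUnit_ne_zero L) (imagUnit_mul_self L) (realDiagonal_isSymm L dV₁ hdV₁) hW
                (isUnit_det_realDiagonal L dV₁ hdV₁ hdV₁0) hWd (realDiagonal_map L dV₁ hdV₁).symm hJW χW
                (isCompatible_chiSplittingLine L e₁ dV₁ hdV₁ hdV₁0 θ hθu hθs (TW (↥(maximalRealSubfield L)) a) hW hWd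
                  (JW (↥(maximalRealSubfield L)) L a) hJW) k x) =
            ((χtw (k, 1) : ℂˣ) : ℂ) •
              Literature.RepresentationTheory.TwistedCoinv.rep ((χtw.comp (MonoidHom.inr _ _))⁻¹ * (χW.comp (MulEquiv.subgroupCongr (finAdelic_JW_eq L a)).symm.toMonoidHom))
                ((finPairRep (Fp L) L (IsCMField.complexConj L) N' 1 e₁ (Matrix.diagonal dV₁) (Matrix.diagonal (lineVec L ((a : ↥(maximalRealSubfield L)) : L))) (complexConj_imagUnit L)
                  (imagUnit_ne_zero L) (imagUnit_mul_self L) (realDiagonal_isSymm L dV₁ hdV₁) (realDiagonal_isSymm L _ (complexConj_lineVec_coe L a))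
                  (isUnit_det_realDiagonal L dV₁ hdV₁ hdV₁0) (isUnit_det_realDiagonal L _ (complexConj_lineVec_coe L a) (lineVec_coe_ne_zero L a)) (realDiagonal_map L dV₁ hdV₁).symm
                  (realDiagonal_map L _ (complexConj_lineVec_coe L a)).symm
                  (splittingOf_isCompatible _ _ _ _ _ _ _ _ _ _ _ _ _ _ _ _ _ h)).comp (MonoidHom.inl _ _))
                (commute_comp_inl_comp_inr _) k (Ψ x) := by
  obtain ⟨Ψ₁, hΨ₁mk, hΨ₁law⟩ := exists_coinv_equiv_TW_lineVec L e₁ dV₁ hdV₁ hdV₁0 θ hθu hθs a hW hWd hJW χW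
  obtain ⟨χtw, hχc, T, hTmk, hTlaw⟩ := exists_coinv_equiv_chiSplitting_splittingOf L e₁ dV₁ hdV₁ hdV₁0
    (lineVec L ((a : ↥(maximalRealSubfield L)) : L)) (complexConj_lineVec_coe L a) (lineVec_coe_ne_zero L a) θ hθu hθs h
    (χW.comp (MulEquiv.subgroupCongr (finAdelic_JW_eq L a)).symm.toMonoidHom)
  refine ⟨χtw, hχc, Ψ₁.trans T, fun f => ?_, fun k x => ?_⟩
  · rw [LinearEquiv.trans_apply, hΨ₁mk, hTmk]
  · rw [LinearEquiv.trans_apply, hΨ₁law, hTlaw, LinearEquiv.trans_apply]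

end Summit.HodgeConjecture.HodgeConjecture.Cruxes.H413.ThetaJunction

end
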